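import Summits.CriticalPhenomena.PercolationContinuityZ3.Theorems.PercNearOneGluingNoHeavyLowerTailStarSetFamilyA0
import HarnessLib

/-!
# `NoHeavyLowerTail` (stmt-CriticalPhenomena-4575) — class-words from explicit designations (U1-PROOF.md §1; blueprint §G1)

Support file (prover `prim-gen-swap` gen 15; `--supports stmt-CriticalPhenomena-4575`).  No definitions, no named facts, no sorries.

Generic bookkeeping for the word side of the U1′_r ledger.  The capacity of a class-set `T` is
`C_T = Σ_{δ valid} Π_{K ∈ T} O K (designated port)`, the sum over the designations `δ : ι → Bool` (`true` ↦ `P K`, `false` ↦ `P' K`)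
supported on `T` whose designated ports are at least three distinct ports avoiding `r`.  For a three-class set `T = {K₁, K₂, K₃}` and
a choice of ports `xᵢ ∈ Kᵢ`, pairwise distinct and `≠ r`, the canonical designation is valid and contributes `O K₁ x₁ · O K₂ x₂ · O K₃ x₃`;
two different port choices contribute their sum.  A version with an extra predicate `Q` on designations (used to split `C_T` between two
families sharing a class-set) is included.

* `StarSet.designation_valid` — validity, designated ports and product of the canonical designation;
* `StarSet.one_word_le_cap_filter`, `StarSet.two_words_le_cap_filter` — one / two explicit words are at most the `Q`-part of `C_T`;
* `StarSet.one_word_le_cap`, `StarSet.two_words_le_cap` — the same with `Q = True` (all of `C_T`).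
-/

namespace Summit.CriticalPhenomena.PercolationContinuityZ3.Theorems

open Finset
open scoped BigOperators Classical

namespace StarSet

variable {ι V : Type*} [Fintype ι] [LinearOrder ι] [DecidableEq V]

/-- **The canonical designation of three ports is a valid class-word.**  For distinct classes `K₁, K₂, K₃`, ports `xᵢ ∈ Kᵢ` pairwise
distinct and `≠ r`, the designation `δ` picking `xᵢ` on `Kᵢ` (and `false` elsewhere) is supported on `T = {K₁, K₂, K₃}`, designates
exactly `{x₁, x₂, x₃}` (three ports, none `= r`), and `Π_{K ∈ T} O K (δ-port) = O K₁ x₁ · O K₂ x₂ · O K₃ x₃`. -/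
theorem designation_valid (P P' : ι → V) (r : V) (O : ι → V → ℝ) {K₁ K₂ K₃ : ι} (h12 : K₁ ≠ K₂) (h13 : K₁ ≠ K₃) (h23 : K₂ ≠ K₃)
    {x₁ x₂ x₃ : V} (hx₁ : P K₁ = x₁ ∨ P' K₁ = x₁) (hx₂ : P K₂ = x₂ ∨ P' K₂ = x₂) (hx₃ : P K₃ = x₃ ∨ P' K₃ = x₃)
    (hx12 : x₁ ≠ x₂) (hx13 : x₁ ≠ x₃) (hx23 : x₂ ≠ x₃) (hx1r : x₁ ≠ r) (hx2r : x₂ ≠ r) (hx3r : x₃ ≠ r) :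
    let δ : ι → Bool := fun K => if K = K₁ then decide (P K₁ = x₁) else if K = K₂ then decide (P K₂ = x₂)
      else if K = K₃ then decide (P K₃ = x₃) else false
    (δ ∈ (univ : Finset (ι → Bool)).filter (fun δ => (∀ K ∉ ({K₁, K₂, K₃} : Finset ι), δ K = false) ∧
          3 ≤ (({K₁, K₂, K₃} : Finset ι).image fun K => if δ K then P K else P' K).card ∧
          r ∉ ({K₁, K₂, K₃} : Finset ι).image fun K => if δ K then P K else P' K)) ∧
      (if δ K₁ then P K₁ else P' K₁) = x₁ ∧ (if δ K₂ then P K₂ else P' K₂) = x₂ ∧ (if δ K₃ then P K₃ else P' K₃) = x₃ ∧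
      ∏ K ∈ ({K₁, K₂, K₃} : Finset ι), O K (if δ K then P K else P' K) = O K₁ x₁ * O K₂ x₂ * O K₃ x₃ := by
  intro δ
  have h1 : (if δ K₁ then P K₁ else P' K₁) = x₁ := by
    simp only [δ, if_pos rfl]; exact pick_port_eq P P' hx₁
  have h2 : (if δ K₂ then P K₂ else P' K₂) = x₂ := by
    simp only [δ, if_neg h12.symm]; exact pick_port_eq P P' hx₂
  have h3 : (if δ K₃ then P K₃ else P' K₃) = x₃ := by
    simp only [δ, if_neg h13.symm, if_neg h23.symm]; exact pick_port_eq P P' hx₃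
  have hK₁not : K₁ ∉ ({K₂, K₃} : Finset ι) := by simp [h12, h13]
  have himg : (({K₁, K₂, K₃} : Finset ι).image fun K => if δ K then P K else P' K) = {x₁, x₂, x₃} := by
    rw [image_insert, image_insert, image_singleton, h1, h2, h3]
  refine ⟨?_, h1, h2, h3, ?_⟩
  · rw [mem_filter, himg]
    refine ⟨mem_univ _, fun K hK => ?_, ?_, ?_⟩
    · simp only [mem_insert, mem_singleton, not_or] at hK
      simp only [δ, if_neg hK.1, if_neg hK.2.1, if_neg hK.2.2]
    · rw [card_insert_of_notMem (by simp [hx12, hx13]), card_pair hx23]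
    · simp [Ne.symm hx1r, Ne.symm hx2r, Ne.symm hx3r]
  · rw [prod_insert hK₁not, prod_pair h23, h1, h2, h3, mul_assoc]

/-- **One explicit word is at most the `Q`-part of the capacity:** `O K₁ x₁ O K₂ x₂ O K₃ x₃ ≤ Σ_{δ valid, Q δ} Π O` when the canonical
designation of `(x₁, x₂, x₃)` satisfies `Q`. -/
theorem one_word_le_cap_filter (P P' : ι → V) (r : V) (O : ι → V → ℝ) (hO0 : ∀ X d, 0 ≤ O X d)
    {K₁ K₂ K₃ : ι} (h12 : K₁ ≠ K₂) (h13 : K₁ ≠ K₃) (h23 : K₂ ≠ K₃)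
    {x₁ x₂ x₃ : V} (hx₁ : P K₁ = x₁ ∨ P' K₁ = x₁) (hx₂ : P K₂ = x₂ ∨ P' K₂ = x₂) (hx₃ : P K₃ = x₃ ∨ P' K₃ = x₃)
    (hx12 : x₁ ≠ x₂) (hx13 : x₁ ≠ x₃) (hx23 : x₂ ≠ x₃) (hx1r : x₁ ≠ r) (hx2r : x₂ ≠ r) (hx3r : x₃ ≠ r)
    (Q : (ι → Bool) → Prop) [DecidablePred Q]
    (hQ : Q (fun K => if K = K₁ then decide (P K₁ = x₁) else if K = K₂ then decide (P K₂ = x₂)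
      else if K = K₃ then decide (P K₃ = x₃) else false)) :
    O K₁ x₁ * O K₂ x₂ * O K₃ x₃ ≤
      ∑ δ ∈ ((univ : Finset (ι → Bool)).filter (fun δ => (∀ K ∉ ({K₁, K₂, K₃} : Finset ι), δ K = false) ∧
          3 ≤ (({K₁, K₂, K₃} : Finset ι).image fun K => if δ K then P K else P' K).card ∧
          r ∉ ({K₁, K₂, K₃} : Finset ι).image fun K => if δ K then P K else P' K)).filter Q,
        ∏ K ∈ ({K₁, K₂, K₃} : Finset ι), O K (if δ K then P K else P' K) := by
  obtain ⟨hmem, -, -, -, hprod⟩ := designation_valid P P' r O h12 h13 h23 hx₁ hx₂ hx₃ hx12 hx13 hx23 hx1r hx2r hx3r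
  rw [← hprod]
  exact single_le_sum (f := fun δ => ∏ K ∈ ({K₁, K₂, K₃} : Finset ι), O K (if δ K then P K else P' K))
    (fun δ _ => prod_nonneg fun K _ => hO0 _ _) (mem_filter.2 ⟨hmem, hQ⟩)

/-- **Two explicit words are at most the `Q`-part of the capacity** (different port choices give different designations). -/
theorem two_words_le_cap_filter (P P' : ι → V) (r : V) (O : ι → V → ℝ) (hO0 : ∀ X d, 0 ≤ O X d)
    {K₁ K₂ K₃ : ι} (h12 : K₁ ≠ K₂) (h13 : K₁ ≠ K₃) (h23 : K₂ ≠ K₃)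
    {x₁ x₂ x₃ : V} (hx₁ : P K₁ = x₁ ∨ P' K₁ = x₁) (hx₂ : P K₂ = x₂ ∨ P' K₂ = x₂) (hx₃ : P K₃ = x₃ ∨ P' K₃ = x₃)
    (hx12 : x₁ ≠ x₂) (hx13 : x₁ ≠ x₃) (hx23 : x₂ ≠ x₃) (hx1r : x₁ ≠ r) (hx2r : x₂ ≠ r) (hx3r : x₃ ≠ r)
    {y₁ y₂ y₃ : V} (hy₁ : P K₁ = y₁ ∨ P' K₁ = y₁) (hy₂ : P K₂ = y₂ ∨ P' K₂ = y₂) (hy₃ : P K₃ = y₃ ∨ P' K₃ = y₃)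
    (hy12 : y₁ ≠ y₂) (hy13 : y₁ ≠ y₃) (hy23 : y₂ ≠ y₃) (hy1r : y₁ ≠ r) (hy2r : y₂ ≠ r) (hy3r : y₃ ≠ r)
    (hxy : x₁ ≠ y₁ ∨ x₂ ≠ y₂ ∨ x₃ ≠ y₃)
    (Q : (ι → Bool) → Prop) [DecidablePred Q]
    (hQx : Q (fun K => if K = K₁ then decide (P K₁ = x₁) else if K = K₂ then decide (P K₂ = x₂)
      else if K = K₃ then decide (P K₃ = x₃) else false))
    (hQy : Q (fun K => if K = K₁ then decide (P K₁ = y₁) else if K = K₂ then decide (P K₂ = y₂)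
      else if K = K₃ then decide (P K₃ = y₃) else false)) :
    O K₁ x₁ * O K₂ x₂ * O K₃ x₃ + O K₁ y₁ * O K₂ y₂ * O K₃ y₃ ≤
      ∑ δ ∈ ((univ : Finset (ι → Bool)).filter (fun δ => (∀ K ∉ ({K₁, K₂, K₃} : Finset ι), δ K = false) ∧
          3 ≤ (({K₁, K₂, K₃} : Finset ι).image fun K => if δ K then P K else P' K).card ∧
          r ∉ ({K₁, K₂, K₃} : Finset ι).image fun K => if δ K then P K else P' K)).filter Q,
        ∏ K ∈ ({K₁, K₂, K₃} : Finset ι), O K (if δ K then P K else P' K) := by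
  obtain ⟨hmemx, hx1, hx2, hx3, hprodx⟩ := designation_valid P P' r O h12 h13 h23 hx₁ hx₂ hx₃ hx12 hx13 hx23 hx1r hx2r hx3r
  obtain ⟨hmemy, hy1, hy2, hy3, hprody⟩ := designation_valid P P' r O h12 h13 h23 hy₁ hy₂ hy₃ hy12 hy13 hy23 hy1r hy2r hy3r
  set δx : ι → Bool := fun K => if K = K₁ then decide (P K₁ = x₁) else if K = K₂ then decide (P K₂ = x₂)
      else if K = K₃ then decide (P K₃ = x₃) else false with hδx
  set δy : ι → Bool := fun K => if K = K₁ then decide (P K₁ = y₁) else if K = K₂ then decide (P K₂ = y₂)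
      else if K = K₃ then decide (P K₃ = y₃) else false with hδy
  have hne : δx ≠ δy := by
    intro h
    rcases hxy with h' | h' | h'
    · apply h'; rw [← hx1, ← hy1, h]
    · apply h'; rw [← hx2, ← hy2, h]
    · apply h'; rw [← hx3, ← hy3, h]
  rw [← hprodx, ← hprody, ← sum_pair (f := fun δ => ∏ K ∈ ({K₁, K₂, K₃} : Finset ι), O K (if δ K then P K else P' K)) hne]
  refine sum_le_sum_of_subset_of_nonneg (fun δ hδ => ?_) fun δ _ _ => prod_nonneg fun K _ => hO0 _ _
  rcases mem_insert.1 hδ with rfl | hδ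
  · exact mem_filter.2 ⟨hmemx, hQx⟩
  · rw [mem_singleton.1 hδ]; exact mem_filter.2 ⟨hmemy, hQy⟩

/-- **One explicit word is at most the capacity `C_T`.** -/
theorem one_word_le_cap (P P' : ι → V) (r : V) (O : ι → V → ℝ) (hO0 : ∀ X d, 0 ≤ O X d)
    {K₁ K₂ K₃ : ι} (h12 : K₁ ≠ K₂) (h13 : K₁ ≠ K₃) (h23 : K₂ ≠ K₃)
    {x₁ x₂ x₃ : V} (hx₁ : P K₁ = x₁ ∨ P' K₁ = x₁) (hx₂ : P K₂ = x₂ ∨ P' K₂ = x₂) (hx₃ : P K₃ = x₃ ∨ P' K₃ = x₃)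
    (hx12 : x₁ ≠ x₂) (hx13 : x₁ ≠ x₃) (hx23 : x₂ ≠ x₃) (hx1r : x₁ ≠ r) (hx2r : x₂ ≠ r) (hx3r : x₃ ≠ r) :
    O K₁ x₁ * O K₂ x₂ * O K₃ x₃ ≤
      ∑ δ ∈ (univ : Finset (ι → Bool)).filter (fun δ => (∀ K ∉ ({K₁, K₂, K₃} : Finset ι), δ K = false) ∧
          3 ≤ (({K₁, K₂, K₃} : Finset ι).image fun K => if δ K then P K else P' K).card ∧
          r ∉ ({K₁, K₂, K₃} : Finset ι).image fun K => if δ K then P K else P' K),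
        ∏ K ∈ ({K₁, K₂, K₃} : Finset ι), O K (if δ K then P K else P' K) := by
  have h := one_word_le_cap_filter P P' r O hO0 h12 h13 h23 hx₁ hx₂ hx₃ hx12 hx13 hx23 hx1r hx2r hx3r (fun _ => True) trivial
  rwa [filter_true_of_mem (fun _ _ => trivial)] at h

/-- **Two explicit words are at most the capacity `C_T`.** -/
theorem two_words_le_cap (P P' : ι → V) (r : V) (O : ι → V → ℝ) (hO0 : ∀ X d, 0 ≤ O X d)
    {K₁ K₂ K₃ : ι} (h12 : K₁ ≠ K₂) (h13 : K₁ ≠ K₃) (h23 : K₂ ≠ K₃)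
    {x₁ x₂ x₃ : V} (hx₁ : P K₁ = x₁ ∨ P' K₁ = x₁) (hx₂ : P K₂ = x₂ ∨ P' K₂ = x₂) (hx₃ : P K₃ = x₃ ∨ P' K₃ = x₃)
    (hx12 : x₁ ≠ x₂) (hx13 : x₁ ≠ x₃) (hx23 : x₂ ≠ x₃) (hx1r : x₁ ≠ r) (hx2r : x₂ ≠ r) (hx3r : x₃ ≠ r)
    {y₁ y₂ y₃ : V} (hy₁ : P K₁ = y₁ ∨ P' K₁ = y₁) (hy₂ : P K₂ = y₂ ∨ P' K₂ = y₂) (hy₃ : P K₃ = y₃ ∨ P' K₃ = y₃)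
    (hy12 : y₁ ≠ y₂) (hy13 : y₁ ≠ y₃) (hy23 : y₂ ≠ y₃) (hy1r : y₁ ≠ r) (hy2r : y₂ ≠ r) (hy3r : y₃ ≠ r)
    (hxy : x₁ ≠ y₁ ∨ x₂ ≠ y₂ ∨ x₃ ≠ y₃) :
    O K₁ x₁ * O K₂ x₂ * O K₃ x₃ + O K₁ y₁ * O K₂ y₂ * O K₃ y₃ ≤
      ∑ δ ∈ (univ : Finset (ι → Bool)).filter (fun δ => (∀ K ∉ ({K₁, K₂, K₃} : Finset ι), δ K = false) ∧
          3 ≤ (({K₁, K₂, K₃} : Finset ι).image fun K => if δ K then P K else P' K).card ∧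
          r ∉ ({K₁, K₂, K₃} : Finset ι).image fun K => if δ K then P K else P' K),
        ∏ K ∈ ({K₁, K₂, K₃} : Finset ι), O K (if δ K then P K else P' K) := by
  have h := two_words_le_cap_filter P P' r O hO0 h12 h13 h23 hx₁ hx₂ hx₃ hx12 hx13 hx23 hx1r hx2r hx3r hy₁ hy₂ hy₃ hy12 hy13 hy23
    hy1r hy2r hy3r hxy (fun _ => True) trivial trivial
  rwa [filter_true_of_mem (fun _ _ => trivial)] at h

end StarSet

end Summit.CriticalPhenomena.PercolationContinuityZ3.Theorems
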